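import Summits.QuantumFields.YangMills.Theorems.UnitScaleTiltProp7ComplementaryProjectorSourceForm
import Summits.QuantumFields.YangMills.Theorems.UnitScaleTiltProp7GaugeProjectorC2SupAllMembers
import HarnessLib

/-!
# Route `UnitScaleTilt`, crux K1 «MinimiserStabilityRegPr» (stmt-QuantumFields-19200), EX row (5) `h3` (STOREY H), pipeline (ii) := «H2-LOC», C6 — **THE FOUR PIN-LETTER ADAPTERS OF THE KNIT**
# (px17 g13 18:21:11Z «GO ADAPTERS», for the member closure (M) `hax_omega_one_member_of_lift` and the family junction (F) `hHωw_family_exists`): the letters `hcompl`∕`hsrc`∕`hGw`∕`hDw` of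
# ✓`Prop7OmegaOneAxialHolderKnit.hax_omega_one` AT ONE MEMBER, each produced from its supplier of record ON THE LOD LIFT LETTERS (the section-variable block of P3v
# ✓`Prop7ComplementaryProjectorSourceForm` VERBATIM: `h : n ≤ K`, `c₀ c₁`, `RegPr` with `0 < ε₀`, `10⁷L³ε₀ ≤ 1`, `Q″ hseq`, `ι hι`, `T hT`, `0 < a`, `G hAG hGA`), with conclusions in the
# knit's binder SHAPES: (A1) `hcompl` ⟸ P3v ✓`sub_projR_eq_G_lift_coeffSum` read at `R_S` through `hRS` — the knit's abstract `cs`∕`Tc` are `cs g := (i ↦ Σ_i′ M⁻¹_{ii′}⟪ψ_i′, g⟫)` and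
# `Tc c := T(Σ_i c i • b i)`; (A2) `hsrc` ⟸ P3v ✓`norm_equiv_complementary_source_apply_le` (chart-site form, `Csrc` = P3v's K-free constant); (A3) `hGw` ⟸ V5b ✓`hGsup_of_regPr`
# (route-site form, `Bw` = V5b's constant); (A4) `hDw` ⟸ ✓`hT1_of_regPr_allMembers` (route-bond form, `Rw` = its constant; NO room).  Zero mathematics: currency conversions `y = e(e⁻¹y)`.

Cell `ym3-torus` (HUMAN RULING D-0037; rung R3 = SU(2) YM₃ on T³ — NOT d = 4, NOT infinite volume, NOT a mass gap, NOT Clay).  Width seat `ym3-torus-px13` (gen 17);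
`--supports stmt-QuantumFields-19200 --as helper`; count-neutral; THEOREMS ONLY (0 `def`, 0 `sorry`, default heartbeats).

HYP-SAT (★★OWNER RULING №42).  Every hypothesis is a letter of the cited supplier files, inhabited by the LOD∕nested-mean families of record (K6∕W-files, P3v's B2c∕V4∕V5 letters); the
conclusions are the knit's `hcompl`∕`hsrc`∕`hGw`∕`hDw` binder texts (✓p782059) up to the instantiation of `cs`∕`Tc`∕`Csrc`∕`Bw`∕`Rw`.  HONEST SCOPE: adapters; nothing of `hUsup`, `h3`,
norm_G, EX, 19200 or the rung is proved; the Yang–Mills mass gap is NOT proved.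

References: T. Bałaban, CMP **99** (1985) 389–434 [Balaban1985BackgroundPropagators] ((3.21)–(3.25) p.394, Thm 3.1 (3.42)–(3.44) pp.397–398, (3.49) p.399, (3.139) p.425); CMP **95** (1984)
17–40 [Balaban1984PropagatorsI] ((1.18) p.20).
-/

set_option autoImplicit false

noncomputable section

open scoped BigOperators Matrix.Norms.L2Operator InnerProductSpace ComplexConjugate Matrix

namespace Summit.QuantumFields.YangMills.Theorems.Prop7OmegaOneKnitAdapters

open Literature.MathematicalPhysics.QuantumFieldTheory.Balaban1983to89
open Literature.MathematicalPhysics.QuantumFieldTheory.Balaban1983to89.T3ContinuumYM3Torus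
open T4Continuum BlockAveraging
open BlockAveraging (Idx off)
open B7Prop1Explicit (disp)
open B5Eq118OneStroke (iterBlockOf)
open B10Eq27TorusAxialLog (holT transl)
open B7TransferAnalyticMean (meanCLM)
open B4Sect5Torus (TSite)
open B9SectCLatticeCarrier (Bond)
open B9Eq311L2Pairing (WL2)
open B11Eq103H1Complex (SiteL2K BondL2K projR)
open Summit.QuantumFields.YangMills.Theorems.Prop8Chart (emlIterU)
open T3SectALandauChart (eta bgUnits)
open T3PrintedRegularMinimiser (RegPr)
open T3PrintedRegularOrbits (sites_eq)
open T3LevelShift (siteShift)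
open Summit.QuantumFields.YangMills.Theorems.Prop7SectET3Transport (periodsT3 siteEquiv bondEquiv)
open Summit.QuantumFields.YangMills.Theorems.Prop7SectET3HilbertLetters (W₂ toL2S DL2 covLapSite)
open Summit.QuantumFields.YangMills.Theorems.Prop7SectET3GaugeProjector (NS RS)
open Summit.QuantumFields.YangMills.Theorems.Prop7CurvedMemberLocalGradient (exists_curved_localGradient)
open Summit.QuantumFields.YangMills.Theorems.AxialGaugeChartGlue (norm_bgOfCfg_axialT_sub_le)
open Summit.QuantumFields.YangMills.Theorems.Prop7SiteEntryCoordinates (orthonormal_spike top_le_span_spike)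
open Summit.QuantumFields.YangMills.Theorems.Prop7ComplementaryProjectorSourceForm (sub_projR_eq_G_lift_coeffSum norm_equiv_complementary_source_apply_le)
open Summit.QuantumFields.YangMills.Theorems.Prop7MassiveSolutionGradientSupOfRegPr (hGsup_of_regPr)
open Summit.QuantumFields.YangMills.Theorems.Prop7GaugeProjectorC2SupAllMembers (hT1_of_regPr_allMembers)

variable (F : T3Family) {n K : ℕ} (h : n ≤ K) {c₀ c₁ : ℝ} [Fact (0 < c₀)] [Fact (0 < c₁)]
  {ε₀ : ℝ} (hε₀ : 0 < ε₀) (hε7 : 10 ^ 7 * (F.L : ℝ) ^ 3 * ε₀ ≤ 1)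
  (U₀ : GaugeField (F.P K) 0 (Matrix.specialUnitaryGroup (Fin 2) ℂ)) (hreg : RegPr F n K ε₀ U₀)
  (Q'' : SiteL2K ℂ 3 (periodsT3 F K) c₀ W₂ →ₗ[ℂ] (Site (F.P K) (K - n) → Matrix (Fin 2) (Fin 2) ℂ))
  (hseq : ∀ lam : Site (F.P K) 0 → Matrix (Fin 2) (Fin 2) ℂ, ∃ ns : (j : ℕ) → Site (F.P K) j → Matrix (Fin 2) (Fin 2) ℂ, ns 0 = lam ∧
      (∀ (j : ℕ) (y : Site (F.P K) (j + 1)), ns (j + 1) y = ns j (emb y) - meanCLM (Idx (F.P K)) (Matrix (Fin 2) (Fin 2) ℂ) fun i : Idx (F.P K) =>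
        ns j (emb y) - ((holT (emlIterU j (bgUnits F K U₀)) (emb y) (stairWord i.2.1 (off i.1)) : (Matrix (Fin 2) (Fin 2) ℂ)ˣ) : Matrix (Fin 2) (Fin 2) ℂ) *
          ns j (transl (emb y) (disp (stairWord i.2.1 (off i.1)))) * (((holT (emlIterU j (bgUnits F K U₀)) (emb y) (stairWord i.2.1 (off i.1)))⁻¹ : (Matrix (Fin 2) (Fin 2) ℂ)ˣ) : Matrix (Fin 2) (Fin 2) ℂ)) ∧
      ns (K - n) = Q'' (toL2S F K c₀ lam))
  (ι : (Site (F.P K) (K - n) → Matrix (Fin 2) (Fin 2) ℂ) →ₗ[ℂ] SiteL2K ℂ 3 (periodsT3 F n) c₁ W₂)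
  (hι : ∀ c, ι c = toL2S F n c₁ (fun z => c (siteShift (sites_eq F n K h) z)))
  (T : SiteL2K ℂ 3 (periodsT3 F n) c₁ W₂ →ₗ[ℂ] SiteL2K ℂ 3 (periodsT3 F K) c₀ W₂)
  (hT : ∀ (l : SiteL2K ℂ 3 (periodsT3 F K) c₀ W₂) (f : SiteL2K ℂ 3 (periodsT3 F n) c₁ W₂), ⟪ι (Q'' l), f⟫_ℂ = ⟪l, T f⟫_ℂ)
  {a : ℝ} (ha : 0 < a)
  (G : SiteL2K ℂ 3 (periodsT3 F K) c₀ W₂ →ₗ[ℂ] SiteL2K ℂ 3 (periodsT3 F K) c₀ W₂)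
  (hAG : ∀ f, covLapSite F n K c₀ U₀ (G f) + (a : ℂ) • T (ι (Q'' (G f))) = f)
  (hGA : ∀ u, G (covLapSite F n K c₀ U₀ u + (a : ℂ) • T (ι (Q'' u))) = u)

/-! ## (A1) `hcompl` — the complementary projector in source form, read at `R_S` -/

include hι hT hAG hGA in
/-- ★ **(A1) THE KNIT's `hcompl`**: under the lift identification `hRS : R_S = projR Δ_{U₀} Q″` and the coarse coercivity `m_B‖f‖ ≤ ‖G(Tf)‖`, for EVERY site field `g`:
`g − R_S g = G(T(Σ_i λ_i(g) • b i))` (P3v ✓`sub_projR_eq_G_lift_coeffSum`) — the knit's `hcompl` with `cs g := (i ↦ Σ_i′ M⁻¹_{ii′}⟪G(T(b i′)), g⟫)`, `Tc c := T(Σ_i c i • b i)`.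
[cite: Balaban1985BackgroundPropagators, (3.21)–(3.25) p.394, (3.49) p.399] -/
theorem hcompl_of_lift {cB : ℝ} [Fact (0 < cB)] (hRS : RS F n K h c₀ cB U₀ = projR (covLapSite F n K c₀ U₀) Q'')
    {mB : ℝ} (hmB : 0 < mB) (hcoer : ∀ f : SiteL2K ℂ 3 (periodsT3 F n) c₁ W₂, mB * ‖f‖ ≤ ‖G (T f)‖) :
    ∀ g : SiteL2K ℂ 3 (periodsT3 F K) c₀ W₂,
      g - RS F n K h c₀ cB U₀ g = G (T (∑ i, (∑ i', (Matrix.of fun i i' : Site (F.P n) 0 × (Fin 2 × Fin 2) => ⟪G (T ((OrthonormalBasis.mk (orthonormal_spike F) (top_le_span_spike F) : OrthonormalBasis (Site (F.P n) 0 × (Fin 2 × Fin 2)) ℂ (SiteL2K ℂ 3 (periodsT3 F n) c₁ W₂)) i)), G (T ((OrthonormalBasis.mk (orthonormal_spike F) (top_le_span_spike F) : OrthonormalBasis (Site (F.P n) 0 × (Fin 2 × Fin 2)) ℂ (SiteL2K ℂ 3 (periodsT3 F n) c₁ W₂)) i'))⟫_ℂ)⁻¹ i i' * ⟪G (T ((OrthonormalBasis.mk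 (orthonormal_spike F) (top_le_span_spike F) : OrthonormalBasis (Site (F.P n) 0 × (Fin 2 × Fin 2)) ℂ (SiteL2K ℂ 3 (periodsT3 F n) c₁ W₂)) i')), g⟫_ℂ) • (OrthonormalBasis.mk (orthonormal_spike F) (top_le_span_spike F) : OrthonormalBasis (Site (F.P n) 0 × (Fin 2 × Fin 2)) ℂ (SiteL2K ℂ 3 (periodsT3 F n) c₁ W₂)) i)) := by
  intro g
  rw [hRS]
  exact sub_projR_eq_G_lift_coeffSum F h U₀ Q'' ι hι T hT G hAG hGA hmB hcoer g

/-! ## (A2) `hsrc` — the sup of the lifted coarse source, chart-site form -/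

include hε₀ hε7 hreg hseq hι hT ha hAG in
/-- ★ **(A2) THE KNIT's `hsrc`**: P3v ✓`norm_equiv_complementary_source_apply_le` (route sites `e x`) read at every chart site `y = e(e⁻¹y)`, with its K-free constant named `Csrc` by `ring`.
[cite: Balaban1985BackgroundPropagators, Thm 3.1 (3.42) p.397, (3.49) p.399] -/
theorem hsrc_of_lift {μ' : ℝ} (hμ' : 0 < μ')
    {δ₁ : ℝ} (hδ₁ : 0 ≤ δ₁)
    (hδ : 3 * ((eta F n K)⁻¹) ^ 2 * (Real.exp (μ' * eta F n K) - 1) ^ 2 + a * ((25 / 8) * (c₁ * ((((F.P K).L : ℝ) ^ (F.P K).d) ^ (K - n))⁻¹ / c₀)) * (Real.exp (3 * μ') - 1) ^ 2 ≤ δ₁ ^ 2)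
    (hwin : Real.sqrt (max 2 (16 * c₀ * ((F.L : ℝ) ^ (K - n)) ^ 3 / (a * c₁))) * δ₁ ≤ 1 / 10)
    {CT : ℝ} (hCT : 0 ≤ CT) (hCTb : ∀ l : SiteL2K ℂ 3 (periodsT3 F K) c₀ W₂, ‖ι (Q'' l)‖ ≤ CT * ‖l‖)
    {CG : ℝ} (hCG : 0 ≤ CG) (hGn : ∀ f, ‖G f‖ ≤ CG * ‖f‖)
    {mB : ℝ} (hmB : 0 < mB) (hcoer : ∀ f : SiteL2K ℂ 3 (periodsT3 F n) c₁ W₂, mB * ‖f‖ ≤ ‖G (T f)‖)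
    (hgap : 3 * ((Real.sqrt (max 2 (16 * c₀ * ((F.L : ℝ) ^ (K - n)) ^ 3 / (a * c₁))) * (2 + Real.sqrt (max 2 (16 * c₀ * ((F.L : ℝ) ^ (K - n)) ^ 3 / (a * c₁)))))
          * (Real.sqrt 3 * (eta F n K)⁻¹ * (Real.exp (μ' * eta F n K) - 1) + (Real.sqrt 3 * (eta F n K)⁻¹ * (Real.exp (μ' * eta F n K) - 1)) ^ 2 + Real.sqrt a * CT * (Real.exp (3 * μ') - 1) + a * CT ^ 2 * (Real.exp (3 * μ') - 1) ^ 2)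
          * (8 * Real.sqrt (max 2 (16 * c₀ * ((F.L : ℝ) ^ (K - n)) ^ 3 / (a * c₁))) + 8 * Real.sqrt (max 2 (16 * c₀ * ((F.L : ℝ) ^ (K - n)) ^ 3 / (a * c₁))) ^ 2)
          * (CT * (1 + (Real.exp (3 * μ') - 1))) + CG * (CT * (Real.exp (3 * μ') - 1))) ^ 2 < mB ^ 2 / 2)
    {Cpt κ : ℝ} (hCpt : 0 ≤ Cpt) (hκ : 0 < κ)
    (hcol : ∀ (y : Site (F.P K) (K - n)) (Y : Matrix (Fin 2) (Fin 2) ℂ) (x : Site (F.P K) 0),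
      ‖WL2.equiv ℂ _ W₂ (G (T (ι (Pi.single y Y)))) (siteEquiv F K x)‖ ≤ Cpt * Real.exp (-(κ * (Site.tdist (P := F.P K) (iterBlockOf (K - n) x) y : ℝ))) * ‖Y‖)
    :
    ∀ (g : SiteL2K ℂ 3 (periodsT3 F K) c₀ W₂) (Vb : ℝ), 0 ≤ Vb →
      (∀ y : TSite 3 (periodsT3 F K), ‖WL2.equiv ℂ (fun _ : TSite 3 (periodsT3 F K) => c₀) W₂ g y‖ ≤ Vb) →
      ∀ y : TSite 3 (periodsT3 F K), ‖WL2.equiv ℂ (fun _ : TSite 3 (periodsT3 F K) => c₀) W₂ (T (∑ i, (∑ i', (Matrix.of fun i i' : Site (F.P n) 0 × (Fin 2 × Fin 2) => ⟪G (T ((OrthonormalBasis.mk (orthonormal_spike F) (top_le_span_spike F) : OrthonormalBasis (Site (F.P n) 0 × (Fin 2 × Fin 2)) ℂ (SiteL2K ℂ 3 (periodsT3 F n) c₁ W₂)) i)), G (T ((OrthonormalBasis.mk (orthonormal_spike F) (top_le_span_spike F) : OrthonormalBasis (Site (F.P n) 0 × (Fin 2 × Fin 2)) ℂ (SiteL2K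 ℂ 3 (periodsT3 F n) c₁ W₂)) i'))⟫_ℂ)⁻¹ i i' * ⟪G (T ((OrthonormalBasis.mk (orthonormal_spike F) (top_le_span_spike F) : OrthonormalBasis (Site (F.P n) 0 × (Fin 2 × Fin 2)) ℂ (SiteL2K ℂ 3 (periodsT3 F n) c₁ W₂)) i')), g⟫_ℂ) • (OrthonormalBasis.mk (orthonormal_spike F) (top_le_span_spike F) : OrthonormalBasis (Site (F.P n) 0 × (Fin 2 × Fin 2)) ℂ (SiteL2K ℂ 3 (periodsT3 F n) c₁ W₂)) i)) y‖
        ≤ (4 * ((5 / 4) * Real.sqrt (2 * c₁) * ((((F.P K).L : ℝ) ^ (F.P K).d) ^ (K - n))⁻¹ / c₀ * (Real.sqrt (2 * c₁) * (Real.sqrt c₁)⁻¹)) * (((mB ^ 2 / 2 - 3 * ((Real.sqrt (max 2 (16 * c₀ * ((F.L : ℝ) ^ (K - n)) ^ 3 / (a * c₁))) * (2 + Real.sqrt (max 2 (16 * c₀ * ((F.L : ℝ) ^ (K - n)) ^ 3 / (a * c₁)))))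
          * (Real.sqrt 3 * (eta F n K)⁻¹ * (Real.exp (μ' * eta F n K) - 1) + (Real.sqrt 3 * (eta F n K)⁻¹ * (Real.exp (μ' * eta F n K) - 1)) ^ 2 + Real.sqrt a * CT * (Real.exp (3 * μ') - 1) + a * CT ^ 2 * (Real.exp (3 * μ') - 1) ^ 2)
          * (8 * Real.sqrt (max 2 (16 * c₀ * ((F.L : ℝ) ^ (K - n)) ^ 3 / (a * c₁))) + 8 * Real.sqrt (max 2 (16 * c₀ * ((F.L : ℝ) ^ (K - n)) ^ 3 / (a * c₁))) ^ 2)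
          * (CT * (1 + (Real.exp (3 * μ') - 1))) + CG * (CT * (Real.exp (3 * μ') - 1))) ^ 2)⁻¹ * Real.exp (9 * μ')) * (4 * (2 * (1 + 1 / μ')) ^ 3) * (c₀ * (Real.sqrt c₁)⁻¹ * Cpt * (((((F.P K).L : ℝ) ^ (F.P K).d) ^ (K - n)) * (2 * (1 + 1 / κ)) ^ 3)))) * Vb := by
  intro g Vb _ hg y
  obtain ⟨x, rfl⟩ := (siteEquiv F K).surjective y
  refine (norm_equiv_complementary_source_apply_le F h hε₀ hε7 U₀ hreg Q'' hseq ι hι T hT ha G hAG hμ' hδ₁ hδ hwin hCT hCTb hCG hGn hmB hcoer hgap hCpt hκ hcol g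
    (fun x' => hg _) x).trans (le_of_eq ?_)
  ring

/-! ## (A3) `hGw` — the value letter of `G_a`, route-site form -/

include hε₀ hε7 hreg hseq hι hT ha hAG in
/-- ★ **(A3) THE KNIT's `hGw`**: V5b ✓`hGsup_of_regPr` (all chart sites) read at the route sites `e x′`, constant `Bw` VERBATIM. [cite: Balaban1985BackgroundPropagators, Thm 3.1 (3.42)∕(3.46) pp.397–398] -/
theorem hGw_of_lift
    {μ : ℝ} (hμ : 0 < μ) {δ₁ : ℝ} (hδ₁ : 0 ≤ δ₁)
    (hδ : 3 * ((eta F n K)⁻¹) ^ 2 * (Real.exp (μ * eta F n K) - 1) ^ 2 + a * ((25 / 8) * (c₁ * ((((F.P K).L : ℝ) ^ (F.P K).d) ^ (K - n))⁻¹ / c₀)) * (Real.exp (3 * μ) - 1) ^ 2 ≤ δ₁ ^ 2)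
    (hwin : Real.sqrt (max 2 (16 * c₀ * ((F.L : ℝ) ^ (K - n)) ^ 3 / (a * c₁))) * δ₁ ≤ 1 / 10) :
    ∀ (f : SiteL2K ℂ 3 (periodsT3 F K) c₀ W₂) (Fb : ℝ), 0 ≤ Fb →
      (∀ x' : Site (F.P K) 0, ‖WL2.equiv ℂ (fun _ : TSite 3 (periodsT3 F K) => c₀) W₂ f (siteEquiv F K x')‖ ≤ Fb) →
      ∀ x' : Site (F.P K) 0, ‖WL2.equiv ℂ (fun _ : TSite 3 (periodsT3 F K) => c₀) W₂ (G f) (siteEquiv F K x')‖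
        ≤ ((((14 * (8 * Real.exp (3 * min μ (1 / 4)) * (1 + Real.exp (3 * μ) * ((a * ((5 / 4) * Real.sqrt (2 * c₁) * ((((F.P K).L : ℝ) ^ (F.P K).d) ^ (K - n))⁻¹ / c₀) * Real.sqrt ((25 / 8) * (c₁ * ((((F.P K).L : ℝ) ^ (F.P K).d) ^ (K - n))⁻¹ / c₀))) * ((8 * Real.sqrt (max 2 (16 * c₀ * ((F.L : ℝ) ^ (K - n)) ^ 3 / (a * c₁))) ^ 2) * (Real.sqrt (c₀ * ((((F.P K).L : ℝ) ^ (F.P K).d) ^ (K - n))) * 1))))))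
          + (Real.sqrt (3 ^ 3 / (c₀ * ((F.L : ℝ) ^ (K - n)) ^ 3) * 8) * (Real.sqrt (8 * Real.exp (3 * min μ (1 / 4)) * Real.exp (6 * μ) * (2 * (1 + 1 / μ)) ^ 3) * ((8 * Real.sqrt (max 2 (16 * c₀ * ((F.L : ℝ) ^ (K - n)) ^ 3 / (a * c₁))) ^ 2) * (Real.sqrt (c₀ * ((((F.P K).L : ℝ) ^ (F.P K).d) ^ (K - n))) * 1)))))
        * (2 * (1 + 1 / (min μ (1 / 4) / 2))) ^ 3)) * Fb := by
  intro f Fb _ hf x'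
  have hf' : ∀ y : TSite 3 (periodsT3 F K), ‖WL2.equiv ℂ (fun _ : TSite 3 (periodsT3 F K) => c₀) W₂ f y‖ ≤ Fb := fun y => by
    obtain ⟨x, rfl⟩ := (siteEquiv F K).surjective y; exact hf x
  exact hGsup_of_regPr F h hε₀ hε7 U₀ hreg Q'' hseq ι hι T hT ha G hAG hμ hδ₁ hδ hwin f Fb hf' (siteEquiv F K x')

/-! ## (A4) `hDw` — the gradient letter of `G_a`, route-bond form, no room -/

include hε₀ hε7 hreg hseq hι hT ha hAG in
/-- ★ **(A4) THE KNIT's `hDw`**: ✓`hT1_of_regPr_allMembers` (`‖D_{U₀}G_a‖_{∞→∞} ≤ R₁` at every member, NO room) read at the route bonds `bondEquiv b`, constant `Rw := R₁` VERBATIM.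
[cite: Balaban1985BackgroundPropagators, Thm 3.1 (3.42)–(3.44) pp.397–398, (3.139) p.425] -/
theorem hDw_of_lift
    {μ : ℝ} (hμ : 0 < μ) {δ₁ : ℝ} (hδ₁ : 0 ≤ δ₁)
    (hδ : 3 * ((eta F n K)⁻¹) ^ 2 * (Real.exp (μ * eta F n K) - 1) ^ 2 + a * ((25 / 8) * (c₁ * ((((F.P K).L : ℝ) ^ (F.P K).d) ^ (K - n))⁻¹ / c₀)) * (Real.exp (3 * μ) - 1) ^ 2 ≤ δ₁ ^ 2)
    (hwin : Real.sqrt (max 2 (16 * c₀ * ((F.L : ℝ) ^ (K - n)) ^ 3 / (a * c₁))) * δ₁ ≤ 1 / 10)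
    (hsmall : exists_curved_localGradient.choose * ((48 * ε₀) * (6 * Real.sqrt 2 * Real.sqrt 10 + 6 * Real.sqrt 2)) ≤ 1 / 2) :
    ∀ (f : SiteL2K ℂ 3 (periodsT3 F K) c₀ W₂) (Fb : ℝ), 0 ≤ Fb →
      (∀ x' : Site (F.P K) 0, ‖WL2.equiv ℂ (fun _ : TSite 3 (periodsT3 F K) => c₀) W₂ f (siteEquiv F K x')‖ ≤ Fb) →
      ∀ b : PBond (F.P K) 0, ‖WL2.equiv ℂ (fun _ : Bond 3 (periodsT3 F K) => c₀) W₂ (DL2 F n K c₀ U₀ (G f)) (bondEquiv F K b)‖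
        ≤ ((2 * (exists_curved_localGradient.choose *
            ((((14 * (8 * Real.exp (3 * min μ (1 / 4)) * (1 + Real.exp (3 * μ) * ((a * ((5 / 4) * Real.sqrt (2 * c₁) * ((((F.P K).L : ℝ) ^ (F.P K).d) ^ (K - n))⁻¹ / c₀) * Real.sqrt ((25 / 8) * (c₁ * ((((F.P K).L : ℝ) ^ (F.P K).d) ^ (K - n))⁻¹ / c₀))) * ((8 * Real.sqrt (max 2 (16 * c₀ * ((F.L : ℝ) ^ (K - n)) ^ 3 / (a * c₁))) ^ 2) * (Real.sqrt (c₀ * ((((F.P K).L : ℝ) ^ (F.P K).d) ^ (K - n))) * 1))))))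
          + (Real.sqrt (3 ^ 3 / (c₀ * ((F.L : ℝ) ^ (K - n)) ^ 3) * 8) * (Real.sqrt (8 * Real.exp (3 * min μ (1 / 4)) * Real.exp (6 * μ) * (2 * (1 + 1 / μ)) ^ 3) * ((8 * Real.sqrt (max 2 (16 * c₀ * ((F.L : ℝ) ^ (K - n)) ^ 3 / (a * c₁))) ^ 2) * (Real.sqrt (c₀ * ((((F.P K).L : ℝ) ^ (F.P K).d) ^ (K - n))) * 1)))))
        * (2 * (1 + 1 / (min μ (1 / 4) / 2))) ^ 3) * (2 + 2 * Real.sqrt 2 * (4 * ε₀ * (3 + 2457 * norm_bgOfCfg_axialT_sub_le.choose)) + (24 * Real.sqrt 10 + 48) * (48 * ε₀) ^ 2)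
              + ((a * ((5 / 4) * Real.sqrt (2 * c₁) * ((((F.P K).L : ℝ) ^ (F.P K).d) ^ (K - n))⁻¹ / c₀) *
          Real.sqrt ((25 / 8) * (c₁ * ((((F.P K).L : ℝ) ^ (F.P K).d) ^ (K - n))⁻¹ / c₀)) *
          (Real.exp (3 * μ) * (8 * Real.sqrt (max 2 (16 * c₀ * ((F.L : ℝ) ^ (K - n)) ^ 3 / (a * c₁))) ^ 2) * (Real.sqrt (c₀ * ((((F.P K).L : ℝ) ^ (F.P K).d) ^ (K - n))) * 1)) * (2 * (1 + 1 / μ)) ^ 3) + 1))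
          + 2 * Real.sqrt 2 * (48 * ε₀) * (((14 * (8 * Real.exp (3 * min μ (1 / 4)) * (1 + Real.exp (3 * μ) * ((a * ((5 / 4) * Real.sqrt (2 * c₁) * ((((F.P K).L : ℝ) ^ (F.P K).d) ^ (K - n))⁻¹ / c₀) * Real.sqrt ((25 / 8) * (c₁ * ((((F.P K).L : ℝ) ^ (F.P K).d) ^ (K - n))⁻¹ / c₀))) * ((8 * Real.sqrt (max 2 (16 * c₀ * ((F.L : ℝ) ^ (K - n)) ^ 3 / (a * c₁))) ^ 2) * (Real.sqrt (c₀ * ((((F.P K).L : ℝ) ^ (F.P K).d) ^ (K - n))) * 1))))))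
          + (Real.sqrt (3 ^ 3 / (c₀ * ((F.L : ℝ) ^ (K - n)) ^ 3) * 8) * (Real.sqrt (8 * Real.exp (3 * min μ (1 / 4)) * Real.exp (6 * μ) * (2 * (1 + 1 / μ)) ^ 3) * ((8 * Real.sqrt (max 2 (16 * c₀ * ((F.L : ℝ) ^ (K - n)) ^ 3 / (a * c₁))) ^ 2) * (Real.sqrt (c₀ * ((((F.P K).L : ℝ) ^ (F.P K).d) ^ (K - n))) * 1)))))
        * (2 * (1 + 1 / (min μ (1 / 4) / 2))) ^ 3)))) * Fb := by
  intro f Fb _ hf b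
  have hf' : ∀ y : TSite 3 (periodsT3 F K), ‖WL2.equiv ℂ (fun _ : TSite 3 (periodsT3 F K) => c₀) W₂ f y‖ ≤ Fb := fun y => by
    obtain ⟨x, rfl⟩ := (siteEquiv F K).surjective y; exact hf x
  exact hT1_of_regPr_allMembers F h hε₀ hε7 U₀ hreg Q'' hseq ι hι T hT ha G hAG hμ hδ₁ hδ hwin hsmall f Fb hf' (bondEquiv F K b)

end Summit.QuantumFields.YangMills.Theorems.Prop7OmegaOneKnitAdapters

end
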